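import Literature.AlgebraicGeometry.Morphisms.CechH1LengthComparison
import Literature.AlgebraicGeometry.FundamentalGroup.ProjectiveLineCharts
import HarnessLib

/-!
# `Ȟ¹(𝒰, 𝒪_X) ≅ Ȟ¹(𝒱, 𝒪_X)` for two affine open covers; affine covers of projective schemes with one-equation complements

Sequel of `Literature/AlgebraicGeometry/Morphisms/CechH1LengthComparison.lean` (the refinement map
`Ȟ¹(𝒰, 𝒪_X) → Ȟ¹(𝒱, 𝒪_X)` of `Morphisms/CechH1Refinement` is BIJECTIVE when the `U_i` are affine and
`𝒱` covers every `U_i`, `cechRefineH1_bijective_of_isAffineOpen`; lengths of `Ȟ¹` of two affine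
covers agree, `length_cechH1_eq_of_isAffineOpen`). For a scheme `f : X → Spec A` and two families of
AFFINE opens `𝒰 = (U_i)_{i ∈ ι}`, `𝒱 = (V_j)_{j ∈ ι'}` both covering `X`:

* `nonempty_linearEquiv_cechH1_of_isAffineOpen` — **independence of the affine cover as an
  `A`-linear isomorphism `Ȟ¹(𝒰, 𝒪_X) ≃ₗ[A] Ȟ¹(𝒱, 𝒪_X)`** (through the common refinement
  `(U_i ∩ V_j)_{(i,j)}`, both refinement maps being bijective);
* `finite_cechH1_iff_of_isAffineOpen`, `finrank_cechH1_eq_of_isAffineOpen` — hence finiteness and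
  the rank `finrank_A Ȟ¹(𝒰, 𝒪_X)` do not depend on the finite affine cover (Hartshorne III Thm. 4.5
  in degree `1`, Čech-internally: no derived functors, no separatedness);
* `exists_isAffineOpen_cover_inf_eq_basicOpen_of_isProjectiveOver` — **a projective `k`-scheme
  `X ↪ ℙᴺ_k` has a finite affine open cover `U_i = X ∩ D₊(x_i)` whose complements are LOCALLY CUT
  OUT BY ONE EQUATION**: every point has an open neighbourhood `W = X ∩ D₊(x_j)` and a section
  `b = x_i/x_j ∈ Γ(X, W)` with `W ∩ U_i = D_W(b)` (Hartshorne II Prop. 2.5: `D₊(x_j) ∩ D₊(x_i) =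
  D₊(x_i x_j)` is the basic open of `x_i/x_j` in `D₊(x_j)`, tree
  `FundamentalGroup.Proj.basicOpen_mul_eq_basicOpen_awayToSection`, pulled back along the closed
  immersion). This is the cover shape under which GAGA-injectivity of `Ȟ¹(𝒪)` is proved cocycle-wise
  (`HodgeTheory/GAGARegularOfHolomorphicNumerator.exists_section_eval_eq_of_sub_eq_eval`); combined
  with the first group of results, rank bounds proved on that cover hold on every finite affine cover.

Everything here is proved; no definitions, no named facts. Mathlib searched (pin): `Proj.basicOpen_mul`,
`Proj.iSup_basicOpen_eq_top`, `Proj.isAffineOpen_basicOpen`, `Scheme.preimage_basicOpen`,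
`IsAffineOpen.preimage`, `LinearEquiv.ofBijective`, `LinearEquiv.finrank_eq`, `Module.Finite.equiv`
(used); Mathlib has no Čech cohomology of schemes beyond degree `0`.

## References

* R. Hartshorne, *Algebraic Geometry*, GTM 52 (1977): II Prop. 2.5 (p. 76), III Thm. 4.5 (p. 222).
  [Hartshorne1977]
* U. Görtz, T. Wedhorn, *Algebraic Geometry II* (2023): Cor. 21.81 (p. 185), Cor. 21.82 (Leray) (p. 186),
  Lemma 22.1 (p. 233). [GortzWedhorn2023]
-/

noncomputable section

open CategoryTheory AlgebraicGeometry Limits TopologicalSpace Opposite HomogeneousLocalization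

universe u v w

namespace Literature.AlgebraicGeometry.Morphisms

/-! ## §1. Two affine covers: `Ȟ¹(𝒰, 𝒪_X) ≃ₗ[A] Ȟ¹(𝒱, 𝒪_X)` -/

section TwoCovers

variable {A : Type u} [CommRing A] {X : Scheme.{u}} (f : X ⟶ Spec (.of A))
  {ι : Type v} {ι' : Type w} (U : ι → X.Opens) (V : ι' → X.Opens)

/-- `U_i ⊆ ⋃_{(i',j)} U_{i'} ∩ V_j` when `𝒱` covers `X`. [folklore] -/
private theorem le_iSup_inf_prod_of_iSup_eq_top_right (hV : ⨆ j, V j = ⊤) (i : ι) :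
    U i ≤ ⨆ p : ι × ι', U p.1 ⊓ V p.2 := by
  intro x hx
  have hxV : x ∈ (⨆ j, V j) := by rw [hV]; trivial
  obtain ⟨j, hj⟩ := Opens.mem_iSup.mp hxV
  exact Opens.mem_iSup.mpr ⟨(i, j), ⟨hx, hj⟩⟩

/-- `V_j ⊆ ⋃_{(i,j')} U_i ∩ V_{j'}` when `𝒰` covers `X`. [folklore] -/
private theorem le_iSup_inf_prod_of_iSup_eq_top_left (hU : ⨆ i, U i = ⊤) (j : ι') :
    V j ≤ ⨆ p : ι × ι', U p.1 ⊓ V p.2 := by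
  intro x hx
  have hxU : x ∈ (⨆ i, U i) := by rw [hU]; trivial
  obtain ⟨i, hi⟩ := Opens.mem_iSup.mp hxU
  exact Opens.mem_iSup.mpr ⟨(i, j), ⟨hi, hx⟩⟩

/-- **Independence of the affine cover: `Ȟ¹(𝒰, 𝒪_X) ≃ₗ[A] Ȟ¹(𝒱, 𝒪_X)`** for two families of AFFINE
opens `𝒰`, `𝒱` of `X → Spec A` both covering `X` — the composite of the refinement isomorphism
`Ȟ¹(𝒰) ⥲ Ȟ¹(𝒲)` to the common refinement `𝒲 = (U_i ∩ V_j)_{(i,j)}` (bijective since the `U_i` are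
affine and `𝒲` covers each `U_i`, tree `cechRefineH1_bijective_of_isAffineOpen`) with the inverse of
`Ȟ¹(𝒱) ⥲ Ȟ¹(𝒲)`. [cite: Hartshorne1977, III Thm. 4.5 p. 222 (cover independence, degree 1)] -/
theorem nonempty_linearEquiv_cechH1_of_isAffineOpen (hUaff : ∀ i, IsAffineOpen (U i))
    (hVaff : ∀ j, IsAffineOpen (V j)) (hU : ⨆ i, U i = ⊤) (hV : ⨆ j, V j = ⊤) :
    Nonempty (CechH1 f U ≃ₗ[A] CechH1 f V) := by
  let W : ι × ι' → X.Opens := fun p => U p.1 ⊓ V p.2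
  have hWU : ∀ i, U i ≤ ⨆ p, W p := le_iSup_inf_prod_of_iSup_eq_top_right U V hV
  have hWV : ∀ j, V j ≤ ⨆ p, W p := le_iSup_inf_prod_of_iSup_eq_top_left U V hU
  exact ⟨(LinearEquiv.ofBijective (cechRefineH1 f U W Prod.fst fun p => inf_le_left)
      (cechRefineH1_bijective_of_isAffineOpen f U W Prod.fst (fun p => inf_le_left) hUaff hWU)).trans
    (LinearEquiv.ofBijective (cechRefineH1 f V W Prod.snd fun p => inf_le_right)
      (cechRefineH1_bijective_of_isAffineOpen f V W Prod.snd (fun p => inf_le_right) hVaff hWV)).symm⟩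

/-- **`Ȟ¹(𝒰, 𝒪_X)` is a finite `A`-module iff `Ȟ¹(𝒱, 𝒪_X)` is**, for two affine open covers `𝒰`, `𝒱`
of `X → Spec A`. [cite: Hartshorne1977, III Thm. 4.5 p. 222 (cover independence, degree 1)] -/
theorem finite_cechH1_iff_of_isAffineOpen (hUaff : ∀ i, IsAffineOpen (U i))
    (hVaff : ∀ j, IsAffineOpen (V j)) (hU : ⨆ i, U i = ⊤) (hV : ⨆ j, V j = ⊤) :
    Module.Finite A (CechH1 f U) ↔ Module.Finite A (CechH1 f V) := by
  obtain ⟨e⟩ := nonempty_linearEquiv_cechH1_of_isAffineOpen f U V hUaff hVaff hU hV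
  exact ⟨fun _ => Module.Finite.equiv e, fun _ => Module.Finite.equiv e.symm⟩

/-- **`finrank_A Ȟ¹(𝒰, 𝒪_X) = finrank_A Ȟ¹(𝒱, 𝒪_X)`** for two affine open covers `𝒰`, `𝒱` of
`X → Spec A`. [cite: Hartshorne1977, III Thm. 4.5 p. 222 (cover independence, degree 1)] -/
theorem finrank_cechH1_eq_of_isAffineOpen (hUaff : ∀ i, IsAffineOpen (U i))
    (hVaff : ∀ j, IsAffineOpen (V j)) (hU : ⨆ i, U i = ⊤) (hV : ⨆ j, V j = ⊤) :
    Module.finrank A (CechH1 f U) = Module.finrank A (CechH1 f V) := by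
  obtain ⟨e⟩ := nonempty_linearEquiv_cechH1_of_isAffineOpen f U V hUaff hVaff hU hV
  exact e.finrank_eq

/-- **Transport of a rank bound along cover independence**: if `Ȟ¹(𝒰, 𝒪_X)` is finite of rank `≤ d`
for ONE affine open cover `𝒰` of `X → Spec A`, the same holds for EVERY affine open cover `𝒱`.
[cite: Hartshorne1977, III Thm. 4.5 p. 222 (cover independence, degree 1)] -/
theorem finite_and_finrank_cechH1_le_of_isAffineOpen (hUaff : ∀ i, IsAffineOpen (U i))
    (hVaff : ∀ j, IsAffineOpen (V j)) (hU : ⨆ i, U i = ⊤) (hV : ⨆ j, V j = ⊤) {d : ℕ}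
    (h : Module.Finite A (CechH1 f U) ∧ Module.finrank A (CechH1 f U) ≤ d) :
    Module.Finite A (CechH1 f V) ∧ Module.finrank A (CechH1 f V) ≤ d :=
  ⟨(finite_cechH1_iff_of_isAffineOpen f U V hUaff hVaff hU hV).1 h.1,
    finrank_cechH1_eq_of_isAffineOpen f U V hUaff hVaff hU hV ▸ h.2⟩

end TwoCovers

/-! ## §2. Projective schemes: an affine cover whose complements are locally one equation -/

section Projective

variable {k : Type u} [Field k] {X : Motives.SchemeOver k}

/-- **The standard affine cover of a projective scheme has complements locally cut out by one
equation.** For `X` projective over a field `k` — a closed `k`-immersion `ι : X ↪ ℙᴺ_k` — the opens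
`U_i = ι⁻¹D₊(x_i)` (`i = 0, …, N`) are affine (`D₊(x_i)` is affine and `ι` is affine), cover `X`
(the `x_i` generate the irrelevant ideal), and for every `i` and every point `x ∈ X`, choosing `j` with
`x ∈ ι⁻¹D₊(x_j) =: W`, the section `b = ι^*(x_i/x_j) ∈ Γ(X, W)` has `W ∩ U_i = D_W(b)` — because
`D₊(x_j) ∩ D₊(x_i) = D₊(x_j x_i)` is the non-vanishing locus of `x_i/x_j` on `D₊(x_j)` and basic opens
pull back to basic opens. [cite: Hartshorne1977, II Prop. 2.5 (p. 76)] -/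
theorem exists_isAffineOpen_cover_inf_eq_basicOpen_of_isProjectiveOver
    (hX : Motives.IsProjectiveOver X) :
    ∃ (N : ℕ) (U : Fin (N + 1) → X.left.Opens), (∀ i, IsAffineOpen (U i)) ∧ ⨆ i, U i = ⊤ ∧
      ∀ (i : Fin (N + 1)) (x : X.left), ∃ (W : X.left.Opens) (b : Γ(X.left, W)),
        x ∈ W ∧ W ⊓ U i = X.left.basicOpen b := by
  obtain ⟨N, ι, hι⟩ := hX
  letI := MvPolynomial.gradedAlgebra (σ := Fin (N + 1)) (R := k)
  -- the closed immersion at its unfolded type `X ⟶ Proj k[x₀, …, x_N]`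
  set r : X.left ⟶ Proj (MvPolynomial.homogeneousSubmodule (Fin (N + 1)) k) := ι.left with hr
  haveI : IsClosedImmersion r := hι
  have Xmem : ∀ s : Fin (N + 1), (MvPolynomial.X s : MvPolynomial (Fin (N + 1)) k) ∈
      MvPolynomial.homogeneousSubmodule (Fin (N + 1)) k 1 := fun s => MvPolynomial.isHomogeneous_X k s
  have htop : ⨆ i, Proj.basicOpen (MvPolynomial.homogeneousSubmodule (Fin (N + 1)) k)
      (MvPolynomial.X i : MvPolynomial (Fin (N + 1)) k) = ⊤ :=
    Proj.iSup_basicOpen_eq_top _ _ (Motives.ProjectiveSpace.irrelevant_le_span N k)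
  refine ⟨N, fun i => r ⁻¹ᵁ Proj.basicOpen _ (MvPolynomial.X i), fun i =>
    (Proj.isAffineOpen_basicOpen _ (MvPolynomial.X i) (Xmem i) one_pos).preimage r, ?_, fun i x => ?_⟩
  · rw [← Scheme.Hom.preimage_iSup, htop]
    rfl
  · -- `x` lies in some chart `ι⁻¹D₊(x_j)`
    have hx : x ∈ r ⁻¹ᵁ (⨆ j, Proj.basicOpen (MvPolynomial.homogeneousSubmodule (Fin (N + 1)) k)
        (MvPolynomial.X j : MvPolynomial (Fin (N + 1)) k)) := by
      rw [htop]; trivial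
    rw [Scheme.Hom.preimage_iSup] at hx
    obtain ⟨j, hj⟩ := Opens.mem_iSup.mp hx
    refine ⟨r ⁻¹ᵁ Proj.basicOpen _ (MvPolynomial.X j),
      r.app _ (Proj.awayToSection _ (MvPolynomial.X j) (Away.isLocalizationElem (Xmem j) (Xmem i))),
      hj, ?_⟩
    rw [← Scheme.Hom.preimage_inf, ← Proj.basicOpen_mul,
      FundamentalGroup.Proj.basicOpen_mul_eq_basicOpen_awayToSection _ (Xmem j) (Xmem i) one_pos one_pos,
      Scheme.preimage_basicOpen]

end Projective

end Literature.AlgebraicGeometry.Morphisms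

end
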